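import Literature.ModelTheory.ExponentialFields.SemialgebraicLenses
import Literature.ModelTheory.ExponentialFields.SemialgebraicFreePieces
import Literature.ModelTheory.ExponentialFields.SemialgebraicDimension
import HarnessLib

/-!
# Collar lenses (capsule refinement subordinate to an open cover, V: Part I assembled)

Topic `Literature/ModelTheory/ExponentialFields` — block B2b′ of the proof of the
`C¹`-triangulation theorem for compact semialgebraic sets
(`Literature.ModelTheory.ExponentialFields.OhmotoShiota2017_c1Triangulation`, statement of
[OhmotoShiota2017, Thm. 1.1]) along the proof of [Pawlucki2024], specialized to `p = 1`.

**Part I of the proof of [Pawlucki2024, Prop. 2.5], assembled.**  For a capsule `[a, b]` over a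
compact semialgebraic `D` whose open fibres are covered by open semialgebraic sets `V j`:
(germs) every nondegenerate fibre has an initial segment `(a x, e]` in one `V j`
(`exists_Ioc_subset_of_cover`, block B2a); (choice) on the semialgebraic pieces `N'_j` of the
nondegenerate locus a semialgebraic collar height `e_j` is chosen (`exists_semialgebraic_choice`),
continuous on the cells of a decomposition [Dries1998, Ch. 6 (1.2); Ch. 3 (2.11)]; (lenses) over
every such cell the lens of block B2b (`LensData.exists_lens`, with the chart of the cell,
[Dries1998, Ch. 3 (2.7)]) gives a pair `bot ≤ top` of continuous semialgebraic functions with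
`(bot x, top x] ⊆ V j` everywhere and `bot = a < top` on the cell.  The finitely many pairs are the
**bottom lenses**; the **top lenses** come from the reflected capsule `[-b, -a]`.  The output is
packaged as `LensFamilies` data (block B2c₂) satisfying its hypotheses.

No named facts are introduced (D-0026).

## References

* [Pawlucki2024] W. Pawłucki, *Strict `C^p`-triangulations — a new approach to
  desingularization*, J. Eur. Math. Soc. 26 (2024), 3863–3909, Prop. 2.5, proof, Part I.
* [Dries1998] L. van den Dries, *Tame topology and o-minimal structures*, Ch. 3 (2.7), (2.11);
  Ch. 6 (1.2).
* [OhmotoShiota2017] T. Ohmoto, M. Shiota, *`C¹`-triangulations of semialgebraic sets*,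
  J. Topology 10 (2017), Thm. 1.1 (statement only).
-/

noncomputable section

open Set Filter Metric
open _root_.Topology

namespace Literature.ModelTheory.ExponentialFields

open Literature.NumberTheory.Transcendental (IsSemialgebraicFunOn IsSemialgebraicMapOn
  isSemialgebraicFunOn_iff isSemialgebraicMapOn_iff_forall_holds)
open Literature.NumberTheory.Transcendental.SemialgebraicMonotonicity (sa_and sa_or sa_not sa_imp
  sa_lt sa_le sa_eq sa_sub_lt sa_reindex sa_exists sa_forall sa_const_lt sa_lt_const sa_le_const
  sa_const_le)

section Collar

variable {m q : ℕ}

/-! ### Coordinate bookkeeping -/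

/-- `Fin.append x y = Fin.snoc x (y 0)` for `y ∈ ℝ¹`. [folklore] -/
theorem append_one_eq_snoc (x : Fin m → ℝ) (y : Fin 1 → ℝ) : Fin.append x y = Fin.snoc x (y 0) := by
  funext i
  refine Fin.lastCases ?_ (fun j => ?_) i
  · have h : Fin.last m = Fin.natAdd m (0 : Fin 1) := by ext; simp
    rw [Fin.snoc_last, h, Fin.append_right]
  · have h : Fin.castSucc j = Fin.castAdd 1 j := rfl
    rw [Fin.snoc_castSucc, h, Fin.append_left]

/-- Coordinates `(y, t) ↦` positions in `w = (y, e, t) ∈ ℝ^{m+2}`. [folklore] -/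
def clσ (m : ℕ) : Fin (m + 1) → Fin (m + 1 + 1) :=
  Fin.snoc (fun i : Fin m => Fin.castSucc (Fin.castSucc i)) (Fin.last (m + 1))

/-- `w ∘ clσ = (y, t)`. [folklore] -/
theorem comp_clσ (w : Fin (m + 1 + 1) → ℝ) :
    w ∘ clσ m = Fin.snoc (Fin.init (Fin.init w)) (w (Fin.last (m + 1))) := by
  funext i
  refine Fin.lastCases ?_ (fun i => ?_) i
  · simp [clσ]
  · simp [clσ, Fin.init]

/-! ### The collar sets -/

/-- The collar relation `Z⁰_j`: `w = (x, e)` with `a x < e`, `2e ≤ a x + b x` and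
`{x} × (a x, e] ⊆ V j`. [cite: Pawlucki2024, Prop. 2.5 (proof, Part I), `ε : A → (0, ∞)`] -/
def collarRel (a b : (Fin m → ℝ) → ℝ) (W : Set (Fin (m + 1) → ℝ)) : Set (Fin (m + 1) → ℝ) :=
  {w | a (Fin.init w) < w (Fin.last m) ∧ 2 * w (Fin.last m) ≤ a (Fin.init w) + b (Fin.init w) ∧
    ∀ t : ℝ, a (Fin.init w) < t → t ≤ w (Fin.last m) → (Fin.snoc (Fin.init w) t : Fin (m + 1) → ℝ) ∈ W}

/-- The collar relation is semialgebraic. [cite: Pawlucki2024, Prop. 2.5] -/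
theorem isSemialgebraic_collarRel {a b : (Fin m → ℝ) → ℝ} (ha : IsSemialgebraicFunOn ℝ univ a)
    (hb : IsSemialgebraicFunOn ℝ univ b) {W : Set (Fin (m + 1) → ℝ)} (hW : IsSemialgebraic ℝ W) :
    IsSemialgebraic ℝ (collarRel a b W) := by
  -- (1) `a (init w) < w last`
  have h1 : IsSemialgebraic ℝ {w : Fin (m + 1) → ℝ | a (Fin.init w) < w (Fin.last m)} := by
    have h := (IsSemialgebraicFunOn.isSemialgebraic_setOf_le tarski_seidenberg_real_holds ha).compl
    convert h using 1
    ext w; simp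
  -- (2) `2 w last ≤ a + b`, i.e. `w last ≤ ((a + b)/2) (init w)`
  have h2 : IsSemialgebraic ℝ {w : Fin (m + 1) → ℝ | 2 * w (Fin.last m) ≤ a (Fin.init w) + b (Fin.init w)} := by
    have hab : IsSemialgebraicFunOn ℝ univ (fun x => (a x + b x) / 2) :=
      IsSemialgebraicFunOn.div₀ isSemialgebraic_univ (IsSemialgebraicFunOn.add_holds ha hb)
        (isSemialgebraicFunOn_const' isSemialgebraic_univ 2)
    have h := IsSemialgebraicFunOn.isSemialgebraic_setOf_le tarski_seidenberg_real_holds hab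
    convert h using 1
    ext w
    simp only [mem_setOf_eq, mem_univ, true_and]
    constructor <;> intro h' <;> linarith
  -- (3) the universal clause
  have h3 : IsSemialgebraic ℝ {w : Fin (m + 1) → ℝ | ∀ t : ℝ, a (Fin.init w) < t → t ≤ w (Fin.last m) →
      (Fin.snoc (Fin.init w) t : Fin (m + 1) → ℝ) ∈ W} := by
    refine sa_forall (n := m + 1) (P := fun w t => a (Fin.init w) < t → t ≤ w (Fin.last m) →
      (Fin.snoc (Fin.init w) t : Fin (m + 1) → ℝ) ∈ W) ?_
    refine sa_imp ?_ (sa_imp ?_ ?_)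
    · -- `a (init (init w')) < w' last`: reindex (1)-type set via `clσ`
      have h := h1.preimage_comp (clσ m)
      convert h using 1
      ext w'
      simp only [mem_setOf_eq, mem_preimage, comp_clσ, Fin.init_snoc, Fin.snoc_last]
    · exact sa_le (n := m + 1 + 1) (Fin.last (m + 1)) (Fin.castSucc (Fin.last m))
    · have h := hW.preimage_comp (clσ m)
      convert h using 1
      ext w'
      simp only [mem_setOf_eq, mem_preimage, comp_clσ]
  convert h1.inter (h2.inter h3) using 1
  ext w
  simp only [collarRel, mem_setOf_eq, mem_inter_iff]

/-- The germ set `N_j = {x ∈ N : ∃ e, (x, e) ∈ Z⁰_j}`. [cite: Pawlucki2024, Prop. 2.5 (proof, Part I)] -/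
def germSet (N : Set (Fin m → ℝ)) (a b : (Fin m → ℝ) → ℝ) (W : Set (Fin (m + 1) → ℝ)) : Set (Fin m → ℝ) :=
  {x | x ∈ N ∧ ∃ e : ℝ, (Fin.snoc x e : Fin (m + 1) → ℝ) ∈ collarRel a b W}

/-- The germ set is semialgebraic. [cite: Pawlucki2024, Prop. 2.5] -/
theorem isSemialgebraic_germSet {N : Set (Fin m → ℝ)} (hN : IsSemialgebraic ℝ N) {a b : (Fin m → ℝ) → ℝ}
    (ha : IsSemialgebraicFunOn ℝ univ a) (hb : IsSemialgebraicFunOn ℝ univ b)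
    {W : Set (Fin (m + 1) → ℝ)} (hW : IsSemialgebraic ℝ W) : IsSemialgebraic ℝ (germSet N a b W) := by
  have h := sa_exists (n := m) (P := fun x e => (Fin.snoc x e : Fin (m + 1) → ℝ) ∈ collarRel a b W) ?_
  · exact hN.inter h
  · convert isSemialgebraic_collarRel ha hb hW using 1
    ext w; simp

/-! ### Bottom lenses -/

/-- **Bottom lenses** [Pawlucki2024, Prop. 2.5, proof, Part I]: finitely many continuous semialgebraic
pairs `bot_i ≤ top_i` on `ℝᵐ` with pieces `(bot_i x, top_i x] ⊆ V (j_i)` for every `x`, serving every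
nondegenerate fibre at its bottom end (`bot_i x = a x < top_i x` for some `i`).
[cite: Pawlucki2024, Prop. 2.5 (proof, Part I)] -/
theorem exists_bottom_lenses {D : Set (Fin m → ℝ)} (hDc : IsCompact D) (hDs : IsSemialgebraic ℝ D)
    {a b : (Fin m → ℝ) → ℝ} (ha : Continuous a)
    (has : IsSemialgebraicFunOn ℝ univ a) (hbs : IsSemialgebraicFunOn ℝ univ b)
    {V : Fin q → Set (Fin (m + 1) → ℝ)} (hVo : ∀ j, IsOpen (V j)) (hVs : ∀ j, IsSemialgebraic ℝ (V j))
    (hcov : ∀ x ∈ D, ∀ t ∈ Ioo (a x) (b x), ∃ j, (Fin.snoc x t : Fin (m + 1) → ℝ) ∈ V j) :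
    ∃ (Ib : ℕ) (bm bp : Fin Ib → (Fin m → ℝ) → ℝ) (jbI : Fin Ib → Fin q),
      (∀ i, Continuous (bm i)) ∧ (∀ i, Continuous (bp i)) ∧
      (∀ i, IsSemialgebraicFunOn ℝ univ (bm i)) ∧ (∀ i, IsSemialgebraicFunOn ℝ univ (bp i)) ∧
      (∀ i x, bm i x ≤ bp i x) ∧
      (∀ i x t, bm i x < t → t ≤ bp i x → (Fin.snoc x t : Fin (m + 1) → ℝ) ∈ V (jbI i)) ∧
      (∀ x ∈ D, a x < b x → ∃ i, bm i x = a x ∧ a x < bp i x) := by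
  classical
  -- the nondegenerate locus and the germ sets
  set N : Set (Fin m → ℝ) := {x | x ∈ D ∧ a x < b x} with hN_def
  have hN : IsSemialgebraic ℝ N := by
    have h := LensFamilies.sa_sep_lt' (has.mono (subset_univ _) hDs) (hbs.mono (subset_univ _) hDs)
    exact h
  set G : Fin q → Set (Fin m → ℝ) := fun j => germSet N a b (V j) with hG_def
  have hG : ∀ j, IsSemialgebraic ℝ (G j) := fun j => isSemialgebraic_germSet hN has hbs (hVs j)
  -- every nondegenerate point has a germ
  have hcovG : ∀ x ∈ N, ∃ j, x ∈ G j := by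
    intro x hx
    obtain ⟨j, e, he, hsub⟩ := exists_Ioc_subset_of_cover (V := V) (a := a) (b := b) (x := x) hVs hx.2 (hcov x hx.1)
    refine ⟨j, hx, min e ((a x + b x) / 2), ?_⟩
    simp only [collarRel, mem_setOf_eq, Fin.init_snoc, Fin.snoc_last]
    refine ⟨lt_min he.1 (by linarith [hx.2]), by linarith [min_le_right e ((a x + b x) / 2)], fun t h1 h2 => ?_⟩
    exact hsub t ⟨h1, h2.trans (min_le_left _ _)⟩
  -- disjointify
  set N' : Fin q → Set (Fin m → ℝ) := fun j => G j \ ⋃ j' ∈ Finset.univ.filter (fun j' : Fin q => j' < j), G j'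
    with hN'_def
  have hN' : ∀ j, IsSemialgebraic ℝ (N' j) := fun j =>
    (hG j).diff (IsSemialgebraic.biUnion _ _ fun j' _ => hG j')
  have hN'G : ∀ j, N' j ⊆ G j := fun j x hx => hx.1
  have hN'N : ∀ j, N' j ⊆ N := fun j x hx => (hN'G j hx).1
  have hcovN' : ∀ x ∈ N, ∃ j, x ∈ N' j := by
    intro x hx
    set J : Finset (Fin q) := Finset.univ.filter fun j => x ∈ G j with hJ
    have hJne : J.Nonempty := by
      obtain ⟨j, hj⟩ := hcovG x hx
      exact ⟨j, Finset.mem_filter.2 ⟨Finset.mem_univ _, hj⟩⟩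
    refine ⟨J.min' hJne, (Finset.mem_filter.1 (J.min'_mem hJne)).2, ?_⟩
    simp only [mem_iUnion, Finset.mem_filter, Finset.mem_univ, true_and, not_exists]
    intro j' hj' hxj'
    have : J.min' hJne ≤ j' := J.min'_le j' (Finset.mem_filter.2 ⟨Finset.mem_univ _, hxj'⟩)
    exact absurd hj' (not_lt.2 this)
  -- the choice sets
  set Z : Fin q → Set (Fin (m + 1) → ℝ) := fun j => {w | Fin.init w ∈ N' j} ∩ collarRel a b (V j) with hZ_def
  have hZ : ∀ j, IsSemialgebraic ℝ (Z j) := fun j => (hN' j).setOf_init_mem.inter (isSemialgebraic_collarRel has hbs (hVs j))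
  have hdom : ∀ j, {x : Fin m → ℝ | ∃ y : Fin 1 → ℝ, Fin.append x y ∈ Z j} = N' j := by
    intro j
    ext x
    simp only [mem_setOf_eq]
    constructor
    · rintro ⟨y, hy⟩
      rw [append_one_eq_snoc] at hy
      have h := hy.1
      simp only [mem_setOf_eq, Fin.init_snoc] at h
      exact h
    · intro hx
      obtain ⟨-, e, he⟩ := hN'G j hx
      refine ⟨fun _ => e, ?_⟩
      rw [append_one_eq_snoc]
      exact ⟨by simp only [mem_setOf_eq, Fin.init_snoc]; exact hx, he⟩
  -- semialgebraic choice of the collar height on each `N' j`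
  have hchoice : ∀ j, ∃ (f : (Fin m → ℝ) → (Fin 1 → ℝ)) (ℬ : Finset (Set (Fin m → ℝ))),
      (∀ x ∈ N' j, (Fin.snoc x (f x 0) : Fin (m + 1) → ℝ) ∈ Z j) ∧
      IsSemialgebraicFunOn ℝ (N' j) (fun x => f x 0) ∧ IsCylindricalDecomposition ℝ m ℬ ∧
      (∀ B ∈ ℬ, (B ∩ N' j).Nonempty → B ⊆ N' j) ∧ ∀ B ∈ ℬ, ContinuousOn f B := by
    intro j
    obtain ⟨f, ℬ, hf, hfs, hℬ, hℬdom, hcont⟩ := exists_semialgebraic_choice (hZ j)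
    rw [hdom j] at hfs
    simp only [hdom j] at hℬdom
    refine ⟨f, ℬ, fun x hx => ?_, ?_, hℬ, hℬdom, hcont⟩
    · have hx' : x ∈ {x : Fin m → ℝ | ∃ y : Fin 1 → ℝ, Fin.append x y ∈ Z j} := by rw [hdom j]; exact hx
      have h := hf x hx'; rw [append_one_eq_snoc] at h; exact h
    · exact (isSemialgebraicMapOn_iff_forall_holds (hN' j)).1 hfs 0
  choose f ℬ hfZ hfs hℬ hℬdom hfcont using hchoice
  -- the lens over each cell `B ∈ ℬ j`, `B ⊆ N' j`
  have hlens : ∀ (j : Fin q) (B : Set (Fin m → ℝ)), B ∈ ℬ j → B ⊆ N' j →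
      ∃ bot top : (Fin m → ℝ) → ℝ, Continuous bot ∧ Continuous top ∧
        IsSemialgebraicFunOn ℝ univ bot ∧ IsSemialgebraicFunOn ℝ univ top ∧ (∀ x, bot x ≤ top x) ∧
        (∀ x t, bot x < t → t ≤ top x → (Fin.snoc x t : Fin (m + 1) → ℝ) ∈ V j) ∧
        (∀ y ∈ B, bot y = a y ∧ a y < top y) := by
    intro j B hB hBN
    obtain ⟨d, hcell⟩ := IsCylindricalDecomposition.exists_isSACell (k := ℝ) (hℬ j) B hB
    obtain ⟨ι, U, φ, -, hU, hUeq, hφc, hφs, hleft, hright⟩ := hcell.exists_chart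
    set L : LensData m d := ⟨B, ι, U, φ, V j, a, fun x => f j x 0⟩ with hL
    have HL : L.Hyp :=
      { Γ_bdd := hDc.isBounded.subset (hBN.trans ((hN'N j).trans fun x hx => hx.1))
        isOpen_U := hU.isOpen rfl
        chart_left := hleft
        chart_mem := fun x hx => by show x ∘ ι ∈ U; rw [hUeq]; exact ⟨x, hx, rfl⟩
        chart_right := hright
        φ_cont := hφc
        isOpen_V := hVo j
        a_cont := ha
        e_cont := (continuous_apply 0).comp_continuousOn (hfcont j B hB)
        a_lt_e := fun y hy => by
          have h := (hfZ j y (hBN hy)).2.1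
          simp only [Fin.init_snoc, Fin.snoc_last] at h
          exact h
        collar := fun y hy t ht => by
          have h := (hfZ j y (hBN hy)).2.2.2
          simp only [Fin.init_snoc, Fin.snoc_last] at h
          exact h t ht.1 ht.2 }
    have SL : L.SA :=
      { Γ_sa := hcell.isSemialgebraic
        U_sa := hU.isSemialgebraic
        φ_sa := hφs
        V_sa := hVs j
        a_sa := has
        e_sa := (hfs j).mono hBN hcell.isSemialgebraic }
    obtain ⟨bot, top, h1, h2, h3, h4, h5, h6, h7⟩ := LensData.exists_lens HL SL
    exact ⟨bot, top, h1, h2, h3, h4, h5, h6, h7⟩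
  -- index the lenses by `T = Σ j, {B ∈ ℬ j : B ⊆ N' j}`
  set T := Σ j : Fin q, ↥((ℬ j).filter fun B => B ⊆ N' j) with hT
  have hlensT : ∀ τ : T, ∃ bot top : (Fin m → ℝ) → ℝ, Continuous bot ∧ Continuous top ∧
      IsSemialgebraicFunOn ℝ univ bot ∧ IsSemialgebraicFunOn ℝ univ top ∧ (∀ x, bot x ≤ top x) ∧
      (∀ x t, bot x < t → t ≤ top x → (Fin.snoc x t : Fin (m + 1) → ℝ) ∈ V τ.1) ∧
      (∀ y ∈ ((τ.2 : Set (Fin m → ℝ))), bot y = a y ∧ a y < top y) := by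
    rintro ⟨j, ⟨B, hB⟩⟩
    obtain ⟨hBmem, hBsub⟩ := Finset.mem_filter.1 hB
    exact hlens j B hBmem hBsub
  choose bot top hbc htc hbs htsa hle hL1 hL2 using hlensT
  set eq := Fintype.equivFin T with heq
  refine ⟨Fintype.card T, fun i => bot (eq.symm i), fun i => top (eq.symm i), fun i => (eq.symm i).1,
    fun i => hbc _, fun i => htc _, fun i => hbs _, fun i => htsa _, fun i x => hle _ x,
    fun i x t h1 h2 => hL1 _ x t h1 h2, fun x hxD hab => ?_⟩
  -- (L2): every nondegenerate point lies in a cell of the right kind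
  have hxN : x ∈ N := ⟨hxD, hab⟩
  obtain ⟨j, hxj⟩ := hcovN' x hxN
  obtain ⟨B, ⟨hB, hxB⟩, -⟩ := (hℬ j).isPartition.2 x
  have hBsub : B ⊆ N' j := hℬdom j B hB ⟨x, hxB, hxj⟩
  set τ : T := ⟨j, ⟨B, Finset.mem_filter.2 ⟨hB, hBsub⟩⟩⟩ with hτ
  refine ⟨eq τ, ?_⟩
  simp only [Equiv.symm_apply_apply]
  exact hL2 τ x hxB

/-! ### Top lenses by reflection, and the lens families -/

/-- Reflection of the last coordinate. [folklore] -/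
def reflectLast (z : Fin (m + 1) → ℝ) : Fin (m + 1) → ℝ := Fin.snoc (Fin.init z) (-(z (Fin.last m)))

/-- `reflectLast (snoc x t) = snoc x (-t)`. [folklore] -/
theorem reflectLast_snoc (x : Fin m → ℝ) (t : ℝ) :
    reflectLast (Fin.snoc x t : Fin (m + 1) → ℝ) = Fin.snoc x (-t) := by
  unfold reflectLast; simp

/-- `reflectLast` is continuous. [folklore] -/
theorem continuous_reflectLast : Continuous (reflectLast (m := m)) := by
  unfold reflectLast
  refine continuous_pi fun i => ?_
  refine Fin.lastCases ?_ (fun j => ?_) i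
  · simp only [Fin.snoc_last]; exact (continuous_apply _).neg
  · simp only [Fin.snoc_castSucc]; exact continuous_apply _

/-- The preimage of a semialgebraic set under `reflectLast` is semialgebraic. [cite: BochnakCosteRoy1998, §2.1] -/
theorem IsSemialgebraic.preimage_reflectLast {W : Set (Fin (m + 1) → ℝ)} (hW : IsSemialgebraic ℝ W) :
    IsSemialgebraic ℝ (reflectLast ⁻¹' W) := by
  have h := hW.preimage_aeval (fun i : Fin (m + 1) => Fin.lastCases (-(MvPolynomial.X (Fin.last m)))
    (fun j => MvPolynomial.X (Fin.castSucc j)) i : Fin (m + 1) → MvPolynomial (Fin (m + 1)) ℝ)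
  convert h using 1
  ext z
  simp only [mem_preimage]
  congr! 1
  funext i
  unfold reflectLast
  refine Fin.lastCases ?_ (fun j => ?_) i
  · simp
  · simp [Fin.init]

/-- **Top lenses** (bottom lenses of the reflected capsule `[-b, -a]`). [cite: Pawlucki2024, Prop. 2.5 (proof, Part II, "and there exist `M ∈ ℒ` and `θ > 0` …")] -/
theorem exists_top_lenses {D : Set (Fin m → ℝ)} (hDc : IsCompact D) (hDs : IsSemialgebraic ℝ D)
    {a b : (Fin m → ℝ) → ℝ} (hb : Continuous b)
    (has : IsSemialgebraicFunOn ℝ univ a) (hbs : IsSemialgebraicFunOn ℝ univ b)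
    {V : Fin q → Set (Fin (m + 1) → ℝ)} (hVo : ∀ j, IsOpen (V j)) (hVs : ∀ j, IsSemialgebraic ℝ (V j))
    (hcov : ∀ x ∈ D, ∀ t ∈ Ioo (a x) (b x), ∃ j, (Fin.snoc x t : Fin (m + 1) → ℝ) ∈ V j) :
    ∃ (It : ℕ) (tm tp : Fin It → (Fin m → ℝ) → ℝ) (jtI : Fin It → Fin q),
      (∀ i, Continuous (tm i)) ∧ (∀ i, Continuous (tp i)) ∧
      (∀ i, IsSemialgebraicFunOn ℝ univ (tm i)) ∧ (∀ i, IsSemialgebraicFunOn ℝ univ (tp i)) ∧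
      (∀ i x, tm i x ≤ tp i x) ∧
      (∀ i x t, tm i x ≤ t → t < tp i x → (Fin.snoc x t : Fin (m + 1) → ℝ) ∈ V (jtI i)) ∧
      (∀ x ∈ D, a x < b x → ∃ i, tp i x = b x ∧ tm i x < b x) := by
  -- reflected data
  set V' : Fin q → Set (Fin (m + 1) → ℝ) := fun j => reflectLast ⁻¹' (V j) with hV'
  have hVo' : ∀ j, IsOpen (V' j) := fun j => (hVo j).preimage continuous_reflectLast
  have hVs' : ∀ j, IsSemialgebraic ℝ (V' j) := fun j => (hVs j).preimage_reflectLast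
  have hcov' : ∀ x ∈ D, ∀ t ∈ Ioo (-b x) (-a x), ∃ j, (Fin.snoc x t : Fin (m + 1) → ℝ) ∈ V' j := by
    intro x hx t ht
    obtain ⟨j, hj⟩ := hcov x hx (-t) ⟨by linarith [ht.2], by linarith [ht.1]⟩
    refine ⟨j, ?_⟩
    show reflectLast (Fin.snoc x t) ∈ V j
    rw [reflectLast_snoc]; exact hj
  obtain ⟨Ib, bm, bp, jbI, hbc, hpc, hbs', hps, hle, hL1, hL2⟩ :=
    exists_bottom_lenses (a := fun x => -b x) (b := fun x => -a x) hDc hDs hb.neg hbs.neg has.neg hVo' hVs' hcov'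
  refine ⟨Ib, fun i x => -bp i x, fun i x => -bm i x, jbI, fun i => (hpc i).neg, fun i => (hbc i).neg,
    fun i => (hps i).neg, fun i => (hbs' i).neg, fun i x => by linarith [hle i x], fun i x t h1 h2 => ?_,
    fun x hx hab => ?_⟩
  · have h := hL1 i x (-t) (by linarith) (by linarith)
    have h' : reflectLast (Fin.snoc x (-t)) ∈ V (jbI i) := h
    rw [reflectLast_snoc, neg_neg] at h'
    exact h'
  · obtain ⟨i, h1, h2⟩ := hL2 x hx (by linarith)
    refine ⟨i, ?_, ?_⟩
    · show -bm i x = b x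
      rw [h1, neg_neg]
    · show -bp i x < b x
      linarith

/-- **Part I of the proof of [Pawlucki2024, Prop. 2.5], assembled as lens families.** For a capsule
`[a, b]` over a compact semialgebraic base whose open fibres are covered by the open semialgebraic
sets `V j`, there are bottom and top lens families as required by block B2c₂.
[cite: Pawlucki2024, Prop. 2.5 (proof, Part I)] -/
theorem exists_lensFamilies {D : Set (Fin m → ℝ)} (hDc : IsCompact D) (hDs : IsSemialgebraic ℝ D)
    {a b : (Fin m → ℝ) → ℝ} (ha : Continuous a) (hb : Continuous b)
    (has : IsSemialgebraicFunOn ℝ univ a) (hbs : IsSemialgebraicFunOn ℝ univ b) (hab : ∀ x ∈ D, a x ≤ b x)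
    {V : Fin q → Set (Fin (m + 1) → ℝ)} (hVo : ∀ j, IsOpen (V j)) (hVs : ∀ j, IsSemialgebraic ℝ (V j))
    (hcov : ∀ x ∈ D, ∀ t ∈ Ioo (a x) (b x), ∃ j, (Fin.snoc x t : Fin (m + 1) → ℝ) ∈ V j) :
    ∃ F : LensFamilies m q, F.D = D ∧ F.a = a ∧ F.b = b ∧ F.V = V ∧ F.Hyp ∧ F.SA := by
  obtain ⟨Ib, bm, bp, jbI, hbc, hpc, hbs', hps, hle, hL1, hL2⟩ := exists_bottom_lenses hDc hDs ha has hbs hVo hVs hcov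
  obtain ⟨It, tm, tp, jtI, htmc, htpc, htms, htps, htle, hL1t, hL2t⟩ := exists_top_lenses hDc hDs hb has hbs hVo hVs hcov
  refine ⟨⟨D, a, b, V, Ib, bm, bp, jbI, It, tm, tp, jtI⟩, rfl, rfl, rfl, rfl, ?_, ?_⟩
  · exact
      { D_closed := hDc.isClosed
        a_cont := ha
        b_cont := hb
        a_le_b := hab
        bm_cont := hbc
        bp_cont := hpc
        tm_cont := htmc
        tp_cont := htpc
        L1b := hL1
        L1t := hL1t
        L2b := hL2
        L2t := hL2t
        cover := hcov }
  · exact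
      { D_sa := hDs
        a_sa := has
        b_sa := hbs
        bm_sa := hbs'
        bp_sa := hps
        tm_sa := htms
        tp_sa := htps }

end Collar

end Literature.ModelTheory.ExponentialFields
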